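import Literature.Geometry.Kaehler.SiegelTorusThetaNullNowhereDense
import HarnessLib

/-!
# `θ_null` is well defined on `𝒜_g`: the vanishing of theta constants and the locus `θ_null` are
# invariant under `Sp_{2g}(ℤ)`

Layer `Literature/Geometry/Kaehler`, namespace `Literature.Geometry.Kaehler.ComplexTorus` (lane
`lit-hodgefound`, Layer A4, theta-divisor row A4-17; prover seat `lit-hodgefound-p23`, row «A4-17(q)»).
Sequel of `SiegelTorusThetaNullRank.lean` (`MemThetaNull`, GSM's `θ_null`), `SiegelTorusThetaParity.lean`
(odd theta constants vanish), `SiegelTorusEvenThetaConstants.lean` (`ϑ[0;0] ≢ 0`),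
`SiegelTorusThetaNullNowhereDense.lean` (`evenThetaNullProd = ∏_{m even} θ_m`) and of the theta
transformation formula `RiemannThetaTransformation.lean` (Lange Thm. 3.3.9 up to the constant:
`exists_riemannThetaChar_transform`, with Lange's action `M[c] = (thetaCharFst, thetaCharSnd)` and the
parity lemma `exists_symplectic_parity`).

Source followed (held text, read at the quoted chunk): S. Grushevsky, R. Salvati Manni, *Jacobians with a
vanishing theta-null in genus 4*, Israel J. Math. 164 (2008), Definitions 5–6 [held
`paper:arxiv-math_0605160` p0004]: "Under the action of `M ∈ Sp(2g,ℤ)` the theta functions transform as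
follows: `θ[M(ε;δ)](M·τ, ᵗ(cτ+d)⁻¹z) = φ(ε, δ, M, τ, z) det(cτ+d)^{1/2} θ[ε;δ](τ, z)`, where
`M(ε;δ) := (d −c; −b a)(ε;δ) + (diag(cᵗd); diag(aᵗb))` taken modulo 2 […] Definition 6. We call the
theta-null divisor `θ_null ⊂ 𝒜_g` the zero locus of the product of all even theta constants. […] By the
above transformation formulae, we see that `θ_null` and `θ_null^h` are well-defined on `𝒜_g` and not
only on the level moduli spaces `𝒜_g(4,8) := ℍ_g/Γ_g(4,8)`."

In the tree's notation (Lange, `M = (α β; γ δ)`): `M[c]¹ = δc¹ − γc² + ½(γᵗδ)₀`,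
`M[c]² = −βc¹ + αc² + ½(αᵗβ)₀`; for a half-integer characteristic `c = (k/2, l/2)` this is
`(k'/2, l'/2)` with `k' = δk − γl + (γᵗδ)₀`, `l' = αl − βk + (αᵗβ)₀` — GSM's `M(ε;δ)`.

What is here (theorems only; no definition, no named fact, net debt `0`):

* **`riemannThetaChar_zero_moeb_eq_const_mul`** — `ϑ[M[c]](0, M(Z)) = C · ϑ[c](0, Z)` with `C ≠ 0`
  (`M ∈ Sp_{2g}(ℤ)`, `Z ∈ 𝔥_g`): the transformation formula at `z = 0`;
  **`riemannThetaChar_zero_moeb_eq_zero_iff`** — a theta constant vanishes at `Z` iff the transformed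
  one vanishes at `M(Z)`.
* `thetaCharFst_half`, `thetaCharSnd_half` — `M[(k/2, l/2)] = (k'/2, l'/2)` with the integral vectors above.
* **`even_diag_dotProduct_diag_of_mem_symplecticGroup`** — for `M ∈ Sp_{2g}(ℤ)`,
  `ᵗ(γᵗδ)₀(αᵗβ)₀` is even, i.e. `M[0]` is an EVEN characteristic (proved analytically: `ϑ[M[0]](0, M(Z))`
  is a non-zero multiple of `ϑ[0;0](0, Z) ≢ 0`, and odd theta constants vanish identically);
  **`even_dotProduct_symplecticChar_iff`** — the action `(k,l) ↦ (k',l')` preserves the parity `ᵗkl mod 2`.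
* **`riemannThetaChar_half_zero_moeb_eq_zero_iff`** — `ϑ[k'/2; l'/2](0, M(Z)) = 0 ↔ ϑ[k/2; l/2](0, Z) = 0`.
* **`MemThetaNull.moeb`**, **`memThetaNull_moeb_iff`** — `M(Z) ∈ θ_null ↔ Z ∈ θ_null`: "`θ_null` is
  well-defined on `𝒜_g = Sp_{2g}(ℤ)\𝔥_g`"; `evenThetaNullProd_moeb_eq_zero_iff`; the translation case
  `memThetaNull_add_intCast_iff`.

Not here: the invariance of the strata `θ_null^h` (the Hessian transforms with `ᵗ(γZ+δ)`), the factor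
`φ det(cτ+d)^{1/2}` (the tree's `RiemannThetaTransformationKappa`), level groups `Γ_g(4,8)`.

## References

* [GrushevskySalvatiManni2008] S. Grushevsky, R. Salvati Manni, *Jacobians with a vanishing theta-null in
  genus 4*, Israel J. Math. 164 (2008), 303–315, Definitions 5–6 (p0004 of the held text).
* [Lange2023AbelianVarietiesComplex] H. Lange, *Abelian Varieties over the Complex Numbers* (2023),
  §3.3.1 Lemma 3.3.1, §3.3.3 Thm. 3.3.9.
* [MumfordTata1] D. Mumford, *Tata Lectures on Theta I*, Ch. II §5.
-/

noncomputable section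

open scoped Manifold Topology
open scoped Real
open Set Function Complex Matrix Filter
open Literature.Analysis.SpecialFunctions Literature.Analysis.Complex

namespace Literature.Geometry.Kaehler

namespace ComplexTorus

open Literature.NumberTheory.Automorphic (siegelUpperHalfSpace)
open Literature.NumberTheory.ModularForms.SiegelUpperHalfSpace (moeb denom moeb_mul moeb_one)

variable {n : ℕ}

/-! ### §1 The transformation formula at `z = 0` -/

/-- **The theta transformation formula at `z = 0`**: for `M ∈ Sp_{2g}(ℤ)` and `Z ∈ 𝔥_g` there is
`C ≠ 0` with `ϑ[M[c]](0, M(Z)) = C · ϑ[c](0, Z)` (`c = (a, b)` any characteristic; `C` is Lange's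
`C(Z, M, a, b)`, GSM's `φ det(cτ+d)^{1/2}`). [cite: Lange2023AbelianVarietiesComplex, §3.3.3 Thm. 3.3.9 (p0175)]
[cite: GrushevskySalvatiManni2008, Definition 5 (p0004 of the held text)] -/
theorem riemannThetaChar_zero_moeb_eq_const_mul {M : Matrix (Fin n ⊕ Fin n) (Fin n ⊕ Fin n) ℤ}
    (hM : M ∈ Matrix.symplecticGroup (Fin n) ℤ) {Z : Matrix (Fin n) (Fin n) ℂ}
    (hZ : Z ∈ siegelUpperHalfSpace n) (a b : Fin n → ℂ) :
    ∃ C : ℂ, C ≠ 0 ∧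
      riemannThetaChar (thetaCharFst M a b) (thetaCharSnd M a b) (moeb (M.map ((↑) : ℤ → ℂ)) Z) 0 =
        C * riemannThetaChar a b Z 0 := by
  obtain ⟨C, hC, h⟩ := exists_riemannThetaChar_transform hM hZ a b
  refine ⟨C, hC, ?_⟩
  have h0 := h 0
  rwa [Matrix.mulVec_zero, zero_dotProduct, mul_zero, Complex.exp_zero, mul_one] at h0

/-- **A theta constant vanishes at `Z` iff the transformed theta constant vanishes at `M(Z)`.**
[cite: GrushevskySalvatiManni2008, Definitions 5–6 (p0004 of the held text)] [cite: Lange2023AbelianVarietiesComplex, §3.3.3 Thm. 3.3.9 (p0175)] -/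
theorem riemannThetaChar_zero_moeb_eq_zero_iff {M : Matrix (Fin n ⊕ Fin n) (Fin n ⊕ Fin n) ℤ}
    (hM : M ∈ Matrix.symplecticGroup (Fin n) ℤ) {Z : Matrix (Fin n) (Fin n) ℂ}
    (hZ : Z ∈ siegelUpperHalfSpace n) (a b : Fin n → ℂ) :
    riemannThetaChar (thetaCharFst M a b) (thetaCharSnd M a b) (moeb (M.map ((↑) : ℤ → ℂ)) Z) 0 = 0 ↔
      riemannThetaChar a b Z 0 = 0 := by
  obtain ⟨C, hC, h⟩ := riemannThetaChar_zero_moeb_eq_const_mul hM hZ a b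
  rw [h, mul_eq_zero, or_iff_right hC]

/-! ### §2 The action on half-integer characteristics -/

/-- Complexified integral matrix times a half-integral vector. [folklore] -/
private theorem map_intCast_mulVec_half (A : Matrix (Fin n) (Fin n) ℤ) (k : Fin n → ℤ) :
    A.map ((↑) : ℤ → ℂ) *ᵥ (fun i ↦ (k i : ℂ) / 2) = fun i ↦ (((A *ᵥ k) i : ℤ) : ℂ) / 2 := by
  funext i
  simp only [Matrix.mulVec, dotProduct, Matrix.map_apply, Int.cast_sum, Int.cast_mul, Finset.sum_div]
  exact Finset.sum_congr rfl fun j _ ↦ by ring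

/-- **`M[(k/2, l/2)]¹ = k'/2` with `k' = δk − γl + (γᵗδ)₀ ∈ ℤ^g`** (GSM: `d ε − c δ + diag(cᵗd)`).
[cite: GrushevskySalvatiManni2008, Definition 5 (p0004 of the held text)] [cite: Lange2023AbelianVarietiesComplex, §3.3.1 Lemma 3.3.1 (b) (p0170)] -/
theorem thetaCharFst_half (M : Matrix (Fin n ⊕ Fin n) (Fin n ⊕ Fin n) ℤ) (k l : Fin n → ℤ) :
    thetaCharFst M (fun i ↦ (k i : ℂ) / 2) (fun i ↦ (l i : ℂ) / 2) = fun i ↦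
      (((M.toBlocks₂₂ *ᵥ k - M.toBlocks₂₁ *ᵥ l + Matrix.diag (M.toBlocks₂₁ * M.toBlocks₂₂ᵀ)) i : ℤ) : ℂ) / 2 := by
  rw [thetaCharFst_def]
  have h₁ : (M.map ((↑) : ℤ → ℂ)).toBlocks₂₂ = M.toBlocks₂₂.map ((↑) : ℤ → ℂ) := rfl
  have h₂ : (M.map ((↑) : ℤ → ℂ)).toBlocks₂₁ = M.toBlocks₂₁.map ((↑) : ℤ → ℂ) := rfl
  rw [h₁, h₂, map_intCast_mulVec_half, map_intCast_mulVec_half]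
  funext i
  simp only [Pi.add_apply, Pi.sub_apply, Pi.smul_apply, smul_eq_mul, Int.cast_add, Int.cast_sub]
  ring

/-- **`M[(k/2, l/2)]² = l'/2` with `l' = αl − βk + (αᵗβ)₀ ∈ ℤ^g`** (GSM: `−b ε + a δ + diag(aᵗb)`).
[cite: GrushevskySalvatiManni2008, Definition 5 (p0004 of the held text)] [cite: Lange2023AbelianVarietiesComplex, §3.3.1 Lemma 3.3.1 (b) (p0170)] -/
theorem thetaCharSnd_half (M : Matrix (Fin n ⊕ Fin n) (Fin n ⊕ Fin n) ℤ) (k l : Fin n → ℤ) :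
    thetaCharSnd M (fun i ↦ (k i : ℂ) / 2) (fun i ↦ (l i : ℂ) / 2) = fun i ↦
      (((M.toBlocks₁₁ *ᵥ l - M.toBlocks₁₂ *ᵥ k + Matrix.diag (M.toBlocks₁₁ * M.toBlocks₁₂ᵀ)) i : ℤ) : ℂ) / 2 := by
  rw [thetaCharSnd_def]
  have h₁ : (M.map ((↑) : ℤ → ℂ)).toBlocks₁₁ = M.toBlocks₁₁.map ((↑) : ℤ → ℂ) := rfl
  have h₂ : (M.map ((↑) : ℤ → ℂ)).toBlocks₁₂ = M.toBlocks₁₂.map ((↑) : ℤ → ℂ) := rfl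
  rw [h₁, h₂, map_intCast_mulVec_half, map_intCast_mulVec_half]
  funext i
  simp only [Pi.add_apply, Pi.sub_apply, Pi.smul_apply, smul_eq_mul, Int.cast_add, Int.cast_sub]
  ring

/-- **The transformation formula at `z = 0` for half-integer characteristics**:
`ϑ[k'/2; l'/2](0, M(Z)) = 0 ↔ ϑ[k/2; l/2](0, Z) = 0` (`M ∈ Sp_{2g}(ℤ)`, `Z ∈ 𝔥_g`).
[cite: GrushevskySalvatiManni2008, Definitions 5–6 (p0004 of the held text)] [cite: Lange2023AbelianVarietiesComplex, §3.3.3 Thm. 3.3.9 (p0175)] -/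
theorem riemannThetaChar_half_zero_moeb_eq_zero_iff {M : Matrix (Fin n ⊕ Fin n) (Fin n ⊕ Fin n) ℤ}
    (hM : M ∈ Matrix.symplecticGroup (Fin n) ℤ) {Z : Matrix (Fin n) (Fin n) ℂ}
    (hZ : Z ∈ siegelUpperHalfSpace n) (k l : Fin n → ℤ) :
    riemannThetaChar
        (fun i ↦ (((M.toBlocks₂₂ *ᵥ k - M.toBlocks₂₁ *ᵥ l + Matrix.diag (M.toBlocks₂₁ * M.toBlocks₂₂ᵀ)) i : ℤ) : ℂ) / 2)
        (fun i ↦ (((M.toBlocks₁₁ *ᵥ l - M.toBlocks₁₂ *ᵥ k + Matrix.diag (M.toBlocks₁₁ * M.toBlocks₁₂ᵀ)) i : ℤ) : ℂ) / 2)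
        (moeb (M.map ((↑) : ℤ → ℂ)) Z) 0 = 0 ↔
      riemannThetaChar (fun i ↦ (k i : ℂ) / 2) (fun i ↦ (l i : ℂ) / 2) Z 0 = 0 := by
  rw [← thetaCharFst_half, ← thetaCharSnd_half]
  exact riemannThetaChar_zero_moeb_eq_zero_iff hM hZ _ _

/-! ### §3 Parity: `M[0]` is even, and `M[·]` preserves the parity of characteristics -/

/-- **`M[0] = (½(γᵗδ)₀, ½(αᵗβ)₀)` is an EVEN characteristic: `ᵗ(γᵗδ)₀(αᵗβ)₀ ≡ 0 (mod 2)` for every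
`M = (α β; γ δ) ∈ Sp_{2g}(ℤ)`.** Proof (analytic): `ϑ[M[0]](0, M(Z)) = C ϑ[0;0](0, Z)` with `C ≠ 0`,
`ϑ[0;0](0, ·) ≢ 0` on `𝔥_g`, and an odd theta constant would vanish identically.
[cite: GrushevskySalvatiManni2008, Definitions 5–6 (p0004 of the held text)] [cite: MumfordTata1, Ch. II §5] -/
theorem even_diag_dotProduct_diag_of_mem_symplecticGroup {M : Matrix (Fin n ⊕ Fin n) (Fin n ⊕ Fin n) ℤ}
    (hM : M ∈ Matrix.symplecticGroup (Fin n) ℤ) :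
    Even (Matrix.diag (M.toBlocks₂₁ * M.toBlocks₂₂ᵀ) ⬝ᵥ Matrix.diag (M.toBlocks₁₁ * M.toBlocks₁₂ᵀ)) := by
  obtain ⟨Z, hZ, hne⟩ := exists_riemannThetaChar_zero_zero_ne_zero (n := n)
  have hZ' := moeb_intCast_mem hM hZ
  -- the transformed characteristic of `[0; 0]`
  have hk : (fun i ↦ (((M.toBlocks₂₂ *ᵥ (0 : Fin n → ℤ) - M.toBlocks₂₁ *ᵥ (0 : Fin n → ℤ) +
      Matrix.diag (M.toBlocks₂₁ * M.toBlocks₂₂ᵀ)) i : ℤ) : ℂ) / 2) =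
      fun i ↦ ((Matrix.diag (M.toBlocks₂₁ * M.toBlocks₂₂ᵀ) i : ℤ) : ℂ) / 2 := by
    funext i; simp
  have hl : (fun i ↦ (((M.toBlocks₁₁ *ᵥ (0 : Fin n → ℤ) - M.toBlocks₁₂ *ᵥ (0 : Fin n → ℤ) +
      Matrix.diag (M.toBlocks₁₁ * M.toBlocks₁₂ᵀ)) i : ℤ) : ℂ) / 2) =
      fun i ↦ ((Matrix.diag (M.toBlocks₁₁ * M.toBlocks₁₂ᵀ) i : ℤ) : ℂ) / 2 := by
    funext i; simp
  have h00 : riemannThetaChar (fun i ↦ (((0 : Fin n → ℤ) i : ℤ) : ℂ) / 2)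
      (fun i ↦ (((0 : Fin n → ℤ) i : ℤ) : ℂ) / 2) Z 0 ≠ 0 := by
    have h0 : (fun i ↦ (((0 : Fin n → ℤ) i : ℤ) : ℂ) / 2) = (0 : Fin n → ℂ) := by
      funext i; simp
    rwa [h0]
  have key := riemannThetaChar_half_zero_moeb_eq_zero_iff hM hZ (0 : Fin n → ℤ) 0
  rw [hk, hl] at key
  refine Int.not_odd_iff_even.1 fun hodd ↦ h00 (key.1 ?_)
  exact riemannThetaChar_half_zero_of_odd _ _ _ hodd

/-- **The symplectic action on characteristics preserves parity**: with `k' = δk − γl + (γᵗδ)₀`,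
`l' = αl − βk + (αᵗβ)₀`, `ᵗk'l' ≡ ᵗkl (mod 2)` — `M(ε;δ)` "taken modulo 2" maps even characteristics to
even ones and odd to odd. [cite: GrushevskySalvatiManni2008, Definitions 5–6 (p0004 of the held text)]
[cite: Lange2023AbelianVarietiesComplex, §3.3.1 proof of Lemma 3.3.1 (p0170)] -/
theorem even_dotProduct_symplecticChar_iff {M : Matrix (Fin n ⊕ Fin n) (Fin n ⊕ Fin n) ℤ}
    (hM : M ∈ Matrix.symplecticGroup (Fin n) ℤ) (k l : Fin n → ℤ) :
    Even ((M.toBlocks₂₂ *ᵥ k - M.toBlocks₂₁ *ᵥ l + Matrix.diag (M.toBlocks₂₁ * M.toBlocks₂₂ᵀ)) ⬝ᵥ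
        (M.toBlocks₁₁ *ᵥ l - M.toBlocks₁₂ *ᵥ k + Matrix.diag (M.toBlocks₁₁ * M.toBlocks₁₂ᵀ))) ↔
      Even (k ⬝ᵥ l) := by
  obtain ⟨m, hm⟩ := exists_symplectic_parity hM k l
  obtain ⟨d, hd⟩ := even_diag_dotProduct_diag_of_mem_symplecticGroup hM
  set μ₁ := M.toBlocks₂₂ *ᵥ k - M.toBlocks₂₁ *ᵥ l
  set μ₂ := M.toBlocks₁₁ *ᵥ l - M.toBlocks₁₂ *ᵥ k
  set d₁ := Matrix.diag (M.toBlocks₂₁ * M.toBlocks₂₂ᵀ)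
  set d₂ := Matrix.diag (M.toBlocks₁₁ * M.toBlocks₁₂ᵀ)
  -- `ᵗ(μ₁ + d₁)(μ₂ + d₂) = ᵗkl + 2m + 2 ᵗd₂μ₁ + ᵗd₁d₂`
  have c1 : μ₁ ⬝ᵥ μ₂ = μ₂ ⬝ᵥ μ₁ := dotProduct_comm _ _
  have c2 : μ₁ ⬝ᵥ d₂ = d₂ ⬝ᵥ μ₁ := dotProduct_comm _ _
  have c3 : l ⬝ᵥ k = k ⬝ᵥ l := dotProduct_comm _ _
  rw [c3] at hm
  have hkey : (μ₁ + d₁) ⬝ᵥ (μ₂ + d₂) = k ⬝ᵥ l + 2 * m + 2 * (d₂ ⬝ᵥ μ₁) + (d + d) := by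
    rw [add_dotProduct, dotProduct_add, dotProduct_add, ← hd, c1, c2]
    linear_combination hm
  rw [hkey]
  constructor
  · rintro ⟨r, hr⟩
    exact ⟨r - m - d₂ ⬝ᵥ μ₁ - d, by linarith⟩
  · rintro ⟨r, hr⟩
    exact ⟨r + m + d₂ ⬝ᵥ μ₁ + d, by linarith⟩

/-! ### §4 `θ_null` is `Sp_{2g}(ℤ)`-invariant -/

/-- **`Z ∈ θ_null ⟹ M(Z) ∈ θ_null`** for `M ∈ Sp_{2g}(ℤ)`, `Z ∈ 𝔥_g`: a vanishing even theta constant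
`ϑ[k/2; l/2](0, Z) = 0` is transported to the vanishing even theta constant `ϑ[k'/2; l'/2](0, M(Z)) = 0`.
[cite: GrushevskySalvatiManni2008, Definition 6 ("θ_null … well-defined on 𝒜_g", p0004 of the held text)] -/
theorem MemThetaNull.moeb {M : Matrix (Fin n ⊕ Fin n) (Fin n ⊕ Fin n) ℤ}
    (hM : M ∈ Matrix.symplecticGroup (Fin n) ℤ) {Z : Matrix (Fin n) (Fin n) ℂ}
    (hZ : Z ∈ siegelUpperHalfSpace n) (h : MemThetaNull Z) :
    MemThetaNull (moeb (M.map ((↑) : ℤ → ℂ)) Z) := by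
  obtain ⟨k, l, heven, h0⟩ := h
  exact ⟨_, _, (even_dotProduct_symplecticChar_iff hM k l).2 heven,
    (riemannThetaChar_half_zero_moeb_eq_zero_iff hM hZ k l).2 h0⟩

/-- `M⁻¹(M(Z)) = Z` on `𝔥_g` for `M ∈ Sp_{2g}(ℤ)`. [cite: Lange2023AbelianVarietiesComplex, §3.1.3 Prop. 3.1.6 (p0160)] -/
theorem moeb_symplecticInv_moeb {M : Matrix (Fin n ⊕ Fin n) (Fin n ⊕ Fin n) ℤ}
    (hM : M ∈ Matrix.symplecticGroup (Fin n) ℤ) {Z : Matrix (Fin n) (Fin n) ℂ}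
    (hZ : Z ∈ siegelUpperHalfSpace n) :
    moeb ((((⟨M, hM⟩ : Matrix.symplecticGroup (Fin n) ℤ)⁻¹ : Matrix.symplecticGroup (Fin n) ℤ) :
        Matrix (Fin n ⊕ Fin n) (Fin n ⊕ Fin n) ℤ).map ((↑) : ℤ → ℂ)) (moeb (M.map ((↑) : ℤ → ℂ)) Z) = Z := by
  have hmul : ((((⟨M, hM⟩ : Matrix.symplecticGroup (Fin n) ℤ)⁻¹ : Matrix.symplecticGroup (Fin n) ℤ) :
      Matrix (Fin n ⊕ Fin n) (Fin n ⊕ Fin n) ℤ)) * M = 1 := by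
    have h1 := congrArg (fun x : Matrix.symplecticGroup (Fin n) ℤ ↦ (x : Matrix (Fin n ⊕ Fin n) (Fin n ⊕ Fin n) ℤ))
      (inv_mul_cancel (⟨M, hM⟩ : Matrix.symplecticGroup (Fin n) ℤ))
    simp only [Submonoid.coe_mul, Submonoid.coe_one] at h1
    exact h1
  have hmap : ((((⟨M, hM⟩ : Matrix.symplecticGroup (Fin n) ℤ)⁻¹ : Matrix.symplecticGroup (Fin n) ℤ) :
      Matrix (Fin n ⊕ Fin n) (Fin n ⊕ Fin n) ℤ) * M).map ((↑) : ℤ → ℂ) =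
      ((((⟨M, hM⟩ : Matrix.symplecticGroup (Fin n) ℤ)⁻¹ : Matrix.symplecticGroup (Fin n) ℤ) :
        Matrix (Fin n ⊕ Fin n) (Fin n ⊕ Fin n) ℤ)).map ((↑) : ℤ → ℂ) * M.map ((↑) : ℤ → ℂ) :=
    Matrix.map_mul (f := Int.castRingHom ℂ)
  rw [← moeb_mul (isUnit_det_denom_intCast hM hZ), ← hmap, hmul,
    Matrix.map_one _ Int.cast_zero Int.cast_one, moeb_one]

/-- **`θ_null` is well-defined on `𝒜_g = Sp_{2g}(ℤ)\𝔥_g`: `M(Z) ∈ θ_null ↔ Z ∈ θ_null`** for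
`M ∈ Sp_{2g}(ℤ)`, `Z ∈ 𝔥_g` ("By the above transformation formulae, we see that `θ_null` […] [is]
well-defined on `𝒜_g`"). [cite: GrushevskySalvatiManni2008, Definition 6 (p0004 of the held text)] -/
theorem memThetaNull_moeb_iff {M : Matrix (Fin n ⊕ Fin n) (Fin n ⊕ Fin n) ℤ}
    (hM : M ∈ Matrix.symplecticGroup (Fin n) ℤ) {Z : Matrix (Fin n) (Fin n) ℂ}
    (hZ : Z ∈ siegelUpperHalfSpace n) :
    MemThetaNull (moeb (M.map ((↑) : ℤ → ℂ)) Z) ↔ MemThetaNull Z := by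
  refine ⟨fun h ↦ ?_, fun h ↦ h.moeb hM hZ⟩
  have h' := h.moeb (((⟨M, hM⟩ : Matrix.symplecticGroup (Fin n) ℤ)⁻¹).2) (moeb_intCast_mem hM hZ)
  rwa [moeb_symplecticInv_moeb hM hZ] at h'

/-- **`∏_{m even} θ_m` vanishes at `M(Z)` iff it vanishes at `Z`** — the zero locus of the product of
the even theta constants (`evenThetaNullProd`, Grushevsky's equation of `θ_null`) is `Sp_{2g}(ℤ)`-stable.
[cite: GrushevskySalvatiManni2008, Definition 6 (p0004 of the held text)] [cite: Grushevsky2012SchottkyProblem, §5 (held p0011)] -/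
theorem evenThetaNullProd_moeb_eq_zero_iff {M : Matrix (Fin n ⊕ Fin n) (Fin n ⊕ Fin n) ℤ}
    (hM : M ∈ Matrix.symplecticGroup (Fin n) ℤ) {Z : Matrix (Fin n) (Fin n) ℂ}
    (hZ : Z ∈ siegelUpperHalfSpace n) :
    evenThetaNullProd (moeb (M.map ((↑) : ℤ → ℂ)) Z) = 0 ↔ evenThetaNullProd Z = 0 := by
  rw [evenThetaNullProd_eq_zero_iff, evenThetaNullProd_eq_zero_iff, memThetaNull_moeb_iff hM hZ]

/-- **The translations `Z ↦ Z + β` (`β` integral symmetric) preserve `θ_null`** — the case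
`M = (1 β; 0 1)`. [cite: GrushevskySalvatiManni2008, Definition 6 (p0004 of the held text)]
[cite: Lange2023AbelianVarietiesComplex, §3.3.4 Exercise (7)(c)] -/
theorem memThetaNull_add_intCast_iff {β : Matrix (Fin n) (Fin n) ℤ} (hβ : β.IsSymm)
    {Z : Matrix (Fin n) (Fin n) ℂ} (hZ : Z ∈ siegelUpperHalfSpace n) :
    MemThetaNull (Z + β.map ((↑) : ℤ → ℂ)) ↔ MemThetaNull Z := by
  rw [← moeb_translation β Z]
  exact memThetaNull_moeb_iff (fromBlocks_one_symm_mem_symplecticGroup hβ) hZ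

end ComplexTorus

end Literature.Geometry.Kaehler

end
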